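import Literature.NumberTheory.Transcendental.ComplexLinearForms
import HarnessLib

/-!
# `ℂ`-linear forms: pointwise multilinearity in plain vectors

Small evaluation lemmas for complex-valued manifold forms `α : MForm 𝓘(ℝ, E) M ℂ k` (`k = 1, 2`)
on constant / `![u, v]` argument vectors with `u v : E` (the tangent spaces of a space charted
on `E` are `E`, but `TangentSpace` is not reducible, so Mathlib's multilinearity lemmas, stated
with `Function.update` on `TangentSpace`-valued vectors, do not rewrite such goals directly):
additivity, `ℂ`-homogeneity for `IsComplexLinearForm` forms (`ComplexLinearForms`), antisymmetry,
and the **determinant rule** `α(a u + b v, c u + d v) = (ad - bc) α(u, v)` for a `ℂ`-bilinear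
alternating `2`-form (`mform₂_apply_lincomb`) — the identity behind the canonical automorphy factor
`det J(γ, z)` of pulled-back `(2,0)`-forms.

References: D. Huybrechts, *Complex Geometry* (2005), §1.2 (forms of type `(p,q)`).
-/

noncomputable section

open Function
open scoped Manifold
open Literature.Geometry.Kaehler (MForm)

namespace Literature.NumberTheory.Transcendental

variable {E : Type*} [NormedAddCommGroup E] [NormedSpace ℂ E] {M : Type*} [TopologicalSpace M]
  [ChartedSpace E M]

/-- On `Fin 1`, updating a constant vector gives a constant vector. [folklore] -/
theorem update_fin1 (x : M) (w w' : TangentSpace 𝓘(ℝ, E) x) :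
    update (fun _ : Fin 1 ↦ w) 0 w' = fun _ ↦ w' := by
  funext i; fin_cases i; simp

/-- `update ![u, v] 0 w = ![w, v]` (tangent vectors). [folklore] -/
theorem update_fin2_zero (x : M) (u v w : TangentSpace 𝓘(ℝ, E) x) :
    update ![u, v] 0 w = ![w, v] := by
  funext i; fin_cases i <;> simp

/-- `update ![u, v] 1 w = ![u, w]` (tangent vectors). [folklore] -/
theorem update_fin2_one (x : M) (u v w : TangentSpace 𝓘(ℝ, E) x) :
    update ![u, v] 1 w = ![u, w] := by
  funext i; fin_cases i <;> simp

/-- A `1`-form is additive in its argument. [folklore] -/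
theorem mform₁_apply_add (α : MForm 𝓘(ℝ, E) M ℂ 1) (x : M) (u v : E) :
    α x (fun _ ↦ u + v) = α x (fun _ ↦ u) + α x (fun _ ↦ v) := by
  have h := (α x).map_update_add (fun _ ↦ u) 0 u v
  rw [update_fin1, update_fin1, update_fin1] at h
  exact h

/-- A `ℂ`-linear `1`-form is `ℂ`-homogeneous in its argument.
[cite: HuybrechtsCG2005, Def. 1.2.7] -/
theorem mform₁_apply_smul {α : MForm 𝓘(ℝ, E) M ℂ 1} (hα : IsComplexLinearForm α) (x : M)
    (c : ℂ) (u : E) : α x (fun _ ↦ c • u) = c * α x (fun _ ↦ u) := by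
  have h := hα x (fun _ ↦ u) 0 c
  rw [update_fin1, tangentSMul_apply] at h
  exact h

/-- A `2`-form is additive in its first argument. [folklore] -/
theorem mform₂_apply_add_left (α : MForm 𝓘(ℝ, E) M ℂ 2) (x : M) (u u' v : E) :
    α x ![u + u', v] = α x ![u, v] + α x ![u', v] := by
  have h := (α x).map_update_add ![u, v] 0 u u'
  rw [update_fin2_zero, update_fin2_zero, update_fin2_zero] at h
  exact h

/-- A `2`-form is additive in its second argument. [folklore] -/
theorem mform₂_apply_add_right (α : MForm 𝓘(ℝ, E) M ℂ 2) (x : M) (u v v' : E) :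
    α x ![u, v + v'] = α x ![u, v] + α x ![u, v'] := by
  have h := (α x).map_update_add ![u, v] 1 v v'
  rw [update_fin2_one, update_fin2_one, update_fin2_one] at h
  exact h

/-- A `ℂ`-bilinear `2`-form is `ℂ`-homogeneous in its first argument.
[cite: HuybrechtsCG2005, Def. 1.2.7] -/
theorem mform₂_apply_smul_left {α : MForm 𝓘(ℝ, E) M ℂ 2} (hα : IsComplexLinearForm α) (x : M)
    (c : ℂ) (u v : E) : α x ![c • u, v] = c * α x ![u, v] := by
  have h := hα x ![u, v] 0 c
  rw [update_fin2_zero, tangentSMul_apply] at h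
  exact h

/-- A `ℂ`-bilinear `2`-form is `ℂ`-homogeneous in its second argument.
[cite: HuybrechtsCG2005, Def. 1.2.7] -/
theorem mform₂_apply_smul_right {α : MForm 𝓘(ℝ, E) M ℂ 2} (hα : IsComplexLinearForm α) (x : M)
    (c : ℂ) (u v : E) : α x ![u, c • v] = c * α x ![u, v] := by
  have h := hα x ![u, v] 1 c
  rw [update_fin2_one, tangentSMul_apply] at h
  exact h

/-- A `2`-form vanishes on a repeated argument. [folklore] -/
theorem mform₂_apply_self (α : MForm 𝓘(ℝ, E) M ℂ 2) (x : M) (u : E) : α x ![u, u] = 0 :=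
  (α x).map_eq_zero_of_eq ![u, u] (i := 0) (j := 1) (by simp) (by decide)

/-- A `2`-form is antisymmetric. [folklore] -/
theorem mform₂_apply_swap (α : MForm 𝓘(ℝ, E) M ℂ 2) (x : M) (u v : E) :
    α x ![v, u] = -α x ![u, v] := by
  have h := mform₂_apply_self α x (u + v)
  rw [mform₂_apply_add_left, mform₂_apply_add_right, mform₂_apply_add_right, mform₂_apply_self,
    mform₂_apply_self, zero_add, add_zero] at h
  exact eq_neg_of_add_eq_zero_right h

/-- **Determinant rule**: a `ℂ`-bilinear alternating `2`-form evaluated on two `ℂ`-linear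
combinations of `u, v` picks up the determinant of the coefficients. [folklore] -/
theorem mform₂_apply_lincomb {α : MForm 𝓘(ℝ, E) M ℂ 2} (hα : IsComplexLinearForm α) (x : M)
    (a b c d : ℂ) (u v : E) :
    α x ![a • u + b • v, c • u + d • v] = (a * d - b * c) * α x ![u, v] := by
  rw [mform₂_apply_add_left, mform₂_apply_smul_left hα, mform₂_apply_smul_left hα,
    mform₂_apply_add_right, mform₂_apply_add_right, mform₂_apply_smul_right hα,
    mform₂_apply_smul_right hα, mform₂_apply_smul_right hα, mform₂_apply_smul_right hα,
    mform₂_apply_self, mform₂_apply_self, mform₂_apply_swap α x u v]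
  ring

end Literature.NumberTheory.Transcendental

end
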